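import Mathlib
import Summits.PneNP.PneNP.Theorems.OverlapGapAlgebraNoStableSectionIndep
import Summits.PneNP.PneNP.Theorems.SolvableImpliesStableSection.Negative.FalseAtEtaZero
import Summits.PneNP.PneNP.Theorems.SolvableImpliesStableSection.Negative.EndpointsFar

/-!
# Crux `SolvableImpliesStableSection` (stmt-PneNP-2463) — negative lemmas, part 5:
# frozen sections fail for EVERY validity level `ν < 2^{-k}` (sharp form of part 3)

Def-free.  Part 3 (`FalseAtEtaZero.lean`) refuted the crux's conclusion for `η ≤ 0` under the crude
entropy condition `h₂(ν) < (1-ν)2^{-k}` (`ν ≲ 2^{-k}/(k log 2)`).  Here the single-instance count is done by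
exponential tilting instead of a union over violated sets (`card_violCount_mul_pow_le`: for a FIXED
assignment `σ` and `0 < t ≤ 1`, `#{Φ : violCount σ Φ ≤ J}·t^J ≤ (1 - 2^{-k}(1-t))^m·#Inst`, the `m`
clauses being independent coordinates, each falsified by `σ` with frequency exactly `2^{-k}`), which
gives the Chernoff rate and hence the SHARP range: `concl_false_of_eta_nonpos_of_lt` — for `k ≥ 1`,
EVERY `α > 0`, `η ≤ 0` and EVERY `0 ≤ ν < 2^{-k}`, the conclusion of the crux at `(k, α, η, ν)` is false
(rate `α·(2^{-k} - ν - ν log(2^{-k}/ν))/2 > 0`, resp. `α 2^{-k}/8` at `ν = 0`).  Since for `ν > 2^{-k}` the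
CONSTANT section realises the path event (`…ConstSection.lean`, any step budget), the frozen/constant
regime is now completely charted: at zero movement the conclusion holds iff `ν > 2^{-k}` (boundary
`ν = 2^{-k}` aside) — independently of the density and of solvability.  (Standing disprover gen-2.)
-/

set_option linter.dupNamespace false

namespace Summit.PneNP.PneNP.Cruxes.SolvableImpliesStableSection.Negative

open Finset
open Summit.PneNP.PneNP.Cruxes.NoStableSection.DartGame (violCount Inst PathSp StableValid
  ind_card_falsified ind_card_notFalsified)

section Tilt

variable {k m n : ℕ}

/-- The tilted clause sum: `Σ_C t^{[σ falsifies C]} = (1 - 2^{-k}(1 - t)) · #clauses`. -/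
theorem sum_tilt_clause (σ : Fin n → Bool) (t : ℝ) :
    ∑ C : Fin k → Fin n × Bool, (if (∀ r, σ (C r).1 ≠ (C r).2) then t else 1) =
      (1 - (1 / 2 : ℝ) ^ k * (1 - t)) * Fintype.card (Fin k → Fin n × Bool) := by
  rw [Finset.sum_ite, Finset.sum_const, Finset.sum_const, nsmul_eq_mul, nsmul_eq_mul, mul_one]
  have h2 := ind_card_notFalsified (k := k) σ
  have hsum := Finset.card_filter_add_card_filter_not
    (s := (univ : Finset (Fin k → Fin n × Bool))) (fun C : Fin k → Fin n × Bool => ∀ r, σ (C r).1 ≠ (C r).2)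
  rw [card_univ] at hsum
  have h1 : ((univ.filter fun C : Fin k → Fin n × Bool => ∀ r, σ (C r).1 ≠ (C r).2).card : ℝ) =
      (1 / 2 : ℝ) ^ k * Fintype.card (Fin k → Fin n × Bool) := by
    have := congrArg (Nat.cast : ℕ → ℝ) hsum
    push_cast at this
    linarith
  rw [h1, h2]
  ring

/-- For a clause array `Φ`, `Π_i t^{[σ falsifies Φ i]} = t^{violCount σ Φ}`. -/
theorem prod_tilt_eq (σ : Fin n → Bool) (t : ℝ) (Φ : Inst m k n) :
    ∏ i : Fin m, (if (∀ r, σ (Φ i r).1 ≠ (Φ i r).2) then t else 1) = t ^ violCount σ Φ := by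
  rw [Finset.prod_ite, Finset.prod_const, Finset.prod_const_one, mul_one]
  rfl

/-- **Tilted single-instance count (Chernoff form).** For a FIXED assignment `σ`, `0 < t ≤ 1` and any
`J`: `#{Φ : violCount σ Φ ≤ J} · t^J ≤ (1 - 2^{-k}(1 - t))^m · #Inst` (the clauses of `Φ` are
independent coordinates; Markov on `t^{violCount}`). -/
theorem card_violCount_mul_pow_le (σ : Fin n → Bool) (J : ℕ) {t : ℝ} (ht0 : 0 < t) (ht1 : t ≤ 1) :
    ((univ.filter fun Φ : Inst m k n => violCount σ Φ ≤ J).card : ℝ) * t ^ J ≤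
      (1 - (1 / 2 : ℝ) ^ k * (1 - t)) ^ m * Fintype.card (Inst m k n) := by
  classical
  set w : Inst m k n → ℝ := fun Φ => ∏ i : Fin m, (if (∀ r, σ (Φ i r).1 ≠ (Φ i r).2) then t else 1)
    with hw
  have hw0 : ∀ Φ, 0 ≤ w Φ := fun Φ => by
    rw [hw]
    exact prod_nonneg fun i _ => by split_ifs <;> linarith
  calc ((univ.filter fun Φ : Inst m k n => violCount σ Φ ≤ J).card : ℝ) * t ^ J
      = ∑ _Φ ∈ univ.filter (fun Φ : Inst m k n => violCount σ Φ ≤ J), t ^ J := by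
        rw [sum_const, nsmul_eq_mul]
    _ ≤ ∑ Φ ∈ univ.filter (fun Φ : Inst m k n => violCount σ Φ ≤ J), w Φ := by
        refine sum_le_sum fun Φ hΦ => ?_
        simp only [mem_filter, mem_univ, true_and] at hΦ
        rw [hw]
        dsimp only
        rw [prod_tilt_eq]
        exact pow_le_pow_of_le_one ht0.le ht1 hΦ
    _ ≤ ∑ Φ, w Φ :=
        sum_le_sum_of_subset_of_nonneg (filter_subset _ _) fun Φ _ _ => hw0 Φ
    _ = ∏ _i : Fin m, ∑ C : Fin k → Fin n × Bool, (if (∀ r, σ (C r).1 ≠ (C r).2) then t else 1) := by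
        rw [hw, Finset.prod_univ_sum]
        simp only [Fintype.piFinset_univ]
    _ = (1 - (1 / 2 : ℝ) ^ k * (1 - t)) ^ m * Fintype.card (Inst m k n) := by
        have hI : (Fintype.card (Inst m k n) : ℝ) = (Fintype.card (Fin k → Fin n × Bool) : ℝ) ^ m := by
          rw [Fintype.card_fun, Fintype.card_fin]
          push_cast
          rfl
        rw [prod_const, card_univ, Fintype.card_fin, sum_tilt_clause, mul_pow, hI]

/-- Hence, with `J ≤ ν m`: `#{Φ : violCount σ Φ ≤ J} ≤ e^{ν m log t⁻¹} e^{-2^{-k}(1-t) m} · #Inst`. -/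
theorem card_violCount_le_exp (σ : Fin n → Bool) {J : ℕ} {ν t : ℝ} (ht0 : 0 < t) (ht1 : t ≤ 1)
    (hJ : (J : ℝ) ≤ ν * m) :
    ((univ.filter fun Φ : Inst m k n => violCount σ Φ ≤ J).card : ℝ) ≤
      Real.exp (ν * m * Real.log t⁻¹) * Real.exp (-((1 / 2 : ℝ) ^ k * (1 - t) * m)) *
        Fintype.card (Inst m k n) := by
  have h := card_violCount_mul_pow_le (m := m) (k := k) σ J ht0 ht1
  have htJ : 0 < t ^ J := pow_pos ht0 J
  have hp0 : 0 ≤ (1 / 2 : ℝ) ^ k := by positivity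
  have hp1 : (1 / 2 : ℝ) ^ k ≤ 1 := pow_le_one₀ (by norm_num) (by norm_num)
  have hbase0 : 0 ≤ 1 - (1 / 2 : ℝ) ^ k * (1 - t) := by nlinarith
  have hpow : (1 - (1 / 2 : ℝ) ^ k * (1 - t)) ^ m ≤ Real.exp (-((1 / 2 : ℝ) ^ k * (1 - t) * m)) := by
    calc (1 - (1 / 2 : ℝ) ^ k * (1 - t)) ^ m ≤ (Real.exp (-((1 / 2 : ℝ) ^ k * (1 - t)))) ^ m :=
          pow_le_pow_left₀ hbase0 (Real.one_sub_le_exp_neg _) m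
      _ = Real.exp (-((1 / 2 : ℝ) ^ k * (1 - t) * m)) := by
          rw [← Real.exp_nat_mul]
          ring_nf
  -- `t^{-J} ≤ e^{ν m log t⁻¹}`
  have hlog0 : 0 ≤ Real.log t⁻¹ := Real.log_nonneg (one_le_inv₀ ht0 |>.2 ht1)
  have hinv : (t ^ J)⁻¹ ≤ Real.exp (ν * m * Real.log t⁻¹) := by
    have e : (t ^ J)⁻¹ = Real.exp (J * Real.log t⁻¹) := by
      rw [Real.exp_nat_mul, Real.exp_log (inv_pos.2 ht0), inv_pow]
    rw [e]
    exact Real.exp_le_exp.2 (mul_le_mul_of_nonneg_right hJ hlog0)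
  have hcard0 : (0 : ℝ) ≤ Fintype.card (Inst m k n) := Nat.cast_nonneg _
  calc ((univ.filter fun Φ : Inst m k n => violCount σ Φ ≤ J).card : ℝ)
      = ((univ.filter fun Φ : Inst m k n => violCount σ Φ ≤ J).card : ℝ) * t ^ J * (t ^ J)⁻¹ := by
        rw [mul_assoc, mul_inv_cancel₀ htJ.ne', mul_one]
    _ ≤ (1 - (1 / 2 : ℝ) ^ k * (1 - t)) ^ m * Fintype.card (Inst m k n) * (t ^ J)⁻¹ :=
        mul_le_mul_of_nonneg_right h (inv_nonneg.2 htJ.le)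
    _ ≤ Real.exp (-((1 / 2 : ℝ) ^ k * (1 - t) * m)) * Fintype.card (Inst m k n) *
          Real.exp (ν * m * Real.log t⁻¹) := by
        gcongr
    _ = _ := by ring

end Tilt

section Main

variable {k : ℕ}

open scoped Classical in
/-- At fixed `(k, m, n)`: for `η ≤ 0`, `0 ≤ ν`, `0 < t ≤ 1` and any `g`, the paths of the crux's event
number at most `e^{ν m log t⁻¹} e^{-2^{-k}(1-t) m} · #paths` (frozen along sweep 0 ⇒ `g (Ψ 0)` is
`ν`-valid for the independent `Ψ 1`; fibrewise product count; tilted single-instance count). -/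
theorem card_stableValid_le_tilt {m n : ℕ} (hk : 1 ≤ k) {η ν t : ℝ} (hη : η ≤ 0) (hν0 : 0 ≤ ν)
    (ht0 : 0 < t) (ht1 : t ≤ 1) (g : Inst m k n → (Fin n → Bool)) :
    ((Finset.univ.filter fun Ψ : PathSp k m n => StableValid g η ν Ψ).card : ℝ) ≤
      (Real.exp (ν * m * Real.log t⁻¹) * Real.exp (-((1 / 2 : ℝ) ^ k * (1 - t) * m))) *
        Fintype.card (PathSp k m n) := by
  classical
  set S : Inst m k n → Finset (Inst m k n) :=
    fun a => univ.filter fun Φ => violCount (g a) Φ ≤ ⌊ν * m⌋₊ with hS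
  have hJ : ((⌊ν * (m : ℝ)⌋₊ : ℕ) : ℝ) ≤ ν * m := Nat.floor_le (by positivity)
  have hD : ∀ a, ((S a).card : ℝ) ≤ (Real.exp (ν * m * Real.log t⁻¹) *
      Real.exp (-((1 / 2 : ℝ) ^ k * (1 - t) * m))) * Fintype.card (Inst m k n) := fun a =>
    card_violCount_le_exp (g a) ht0 ht1 hJ
  have hsub : (Finset.univ.filter fun Ψ : PathSp k m n => StableValid g η ν Ψ) ⊆
      Finset.univ.filter fun Ψ : PathSp k m n => Ψ (⟨0, hk⟩ : Fin k).succ ∈ S (Ψ 0) := by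
    intro Ψ hΨ
    simp only [Finset.mem_filter, Finset.mem_univ, true_and, hS] at hΨ ⊢
    exact Nat.le_floor (violCount_far_le hk hη hΨ)
  calc ((Finset.univ.filter fun Ψ : PathSp k m n => StableValid g η ν Ψ).card : ℝ)
      ≤ ((Finset.univ.filter fun Ψ : PathSp k m n =>
          Ψ (⟨0, hk⟩ : Fin k).succ ∈ S (Ψ 0)).card : ℝ) := by
        exact_mod_cast Finset.card_le_card hsub
    _ ≤ _ := card_far_mem_le hk S hD

/-- **Rate form.** For `k ≥ 1`, `α > 0`, `η ≤ 0`, `0 ≤ ν`, a tilt `0 < t ≤ 1` and a rate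
`0 < c < α (2^{-k}(1-t) - ν log t⁻¹)`: the conclusion of the crux at `(k, α, η, ν)` (verbatim) fails. -/
theorem concl_false_of_eta_nonpos_tilt (hk : 1 ≤ k) {α η ν t c : ℝ} (hα : 0 < α) (hη : η ≤ 0)
    (hν0 : 0 ≤ ν) (ht0 : 0 < t) (ht1 : t ≤ 1) (hc : 0 < c)
    (hrate : c < α * ((1 / 2 : ℝ) ^ k * (1 - t) - ν * Real.log t⁻¹)) :
    ¬ (∀ c : ℝ, 0 < c → ∃ᶠ n : ℕ in Filter.atTop, ∀ m : ℕ, m = ⌊α * n⌋₊ →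
      ∃ g : (Fin m → Fin k → Fin n × Bool) → (Fin n → Bool),
        Real.exp (-(c * n)) * Fintype.card (Fin (k + 1) → Fin m → Fin k → Fin n × Bool) ≤
        ((Finset.univ.filter fun Ψ : Fin (k + 1) → Fin m → Fin k → Fin n × Bool =>
          let P : Fin k → ℕ → Fin m → Fin k → Fin n × Bool :=
            fun r q a b => if (a : ℕ) * k + b < q then Ψ r.succ a b else Ψ r.castSucc a b
          (∀ r : Fin k, ∀ q ≤ m * k, ((Finset.univ.filter fun i : Fin m =>
            ∀ j, g (P r q) (P r q i j).1 ≠ (P r q i j).2).card : ℝ) ≤ ν * m) ∧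
          ∀ r : Fin k, ∀ q < m * k,
            (hammingDist (g (P r q)) (g (P r (q + 1))) : ℝ) ≤ η * n).card : ℝ)) := by
  classical
  intro hC
  set φ : ℝ := (1 / 2 : ℝ) ^ k * (1 - t) - ν * Real.log t⁻¹ with hφ
  have hφpos : 0 < α * φ := lt_trans hc hrate
  have hφ0 : 0 < φ := pos_of_mul_pos_right hφpos hα.le
  -- eventually `e^{-⌊αn⌋ φ} < e^{-cn}`
  have hev : ∀ᶠ n : ℕ in Filter.atTop,
      Real.exp (ν * ⌊α * (n : ℝ)⌋₊ * Real.log t⁻¹) *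
        Real.exp (-((1 / 2 : ℝ) ^ k * (1 - t) * ⌊α * (n : ℝ)⌋₊)) < Real.exp (-(c * n)) := by
    filter_upwards [Filter.eventually_gt_atTop (⌈φ / (α * φ - c)⌉₊)] with n hn
    have hgap : 0 < α * φ - c := by linarith
    have hn' : φ / (α * φ - c) < n := lt_of_le_of_lt (Nat.le_ceil _) (by exact_mod_cast hn)
    have hn'' : φ < n * (α * φ - c) := (div_lt_iff₀ hgap).1 hn'
    have hM : α * n - 1 < (⌊α * (n : ℝ)⌋₊ : ℝ) := by
      have := Nat.lt_floor_add_one (α * (n : ℝ))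
      linarith
    rw [← Real.exp_add]
    refine Real.exp_lt_exp.2 ?_
    have e : ν * ⌊α * (n : ℝ)⌋₊ * Real.log t⁻¹ + -((1 / 2 : ℝ) ^ k * (1 - t) * ⌊α * (n : ℝ)⌋₊) =
        -(⌊α * (n : ℝ)⌋₊ * φ) := by rw [hφ]; ring
    rw [e]
    nlinarith
  obtain ⟨n, hn, hlt, hn1⟩ := ((hC c hc).and_eventually (hev.and (Filter.eventually_ge_atTop 1))).exists
  obtain ⟨g, hg⟩ := hn _ rfl
  have hcard := card_paths_pos k ⌊α * (n : ℝ)⌋₊ hn1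
  have hle := card_stableValid_le_tilt (m := ⌊α * (n : ℝ)⌋₊) (n := n) hk hη hν0 ht0 ht1 g
  refine absurd hg (not_le.2 (lt_of_le_of_lt (le_trans ?_ hle) (mul_lt_mul_of_pos_right hlt hcard)))
  exact_mod_cast Finset.card_le_card fun Ψ hΨ => by
    simp only [Finset.mem_filter, Finset.mem_univ, true_and] at hΨ ⊢
    exact hΨ

/-- **Frozen sections fail for every `ν < 2^{-k}`, at every density.** For `k ≥ 1`, `α > 0`, `η ≤ 0`
and `0 ≤ ν < 2^{-k}` the conclusion of the crux at `(k, α, η, ν)` is false (tilt `t = ν 2^k` for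
`ν > 0`: rate `2^{-k} - ν - ν log(2^{-k}/ν) > 0` by `log x < x - 1`; `t = 1/2` for `ν = 0`).  Sharp: for
`ν > 2^{-k}` the constant section realises the path event (`…ConstSection.lean`). -/
theorem concl_false_of_eta_nonpos_of_lt (hk : 1 ≤ k) {α η ν : ℝ} (hα : 0 < α) (hη : η ≤ 0)
    (hν0 : 0 ≤ ν) (hνp : ν < (1 / 2 : ℝ) ^ k) :
    ¬ (∀ c : ℝ, 0 < c → ∃ᶠ n : ℕ in Filter.atTop, ∀ m : ℕ, m = ⌊α * n⌋₊ →
      ∃ g : (Fin m → Fin k → Fin n × Bool) → (Fin n → Bool),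
        Real.exp (-(c * n)) * Fintype.card (Fin (k + 1) → Fin m → Fin k → Fin n × Bool) ≤
        ((Finset.univ.filter fun Ψ : Fin (k + 1) → Fin m → Fin k → Fin n × Bool =>
          let P : Fin k → ℕ → Fin m → Fin k → Fin n × Bool :=
            fun r q a b => if (a : ℕ) * k + b < q then Ψ r.succ a b else Ψ r.castSucc a b
          (∀ r : Fin k, ∀ q ≤ m * k, ((Finset.univ.filter fun i : Fin m =>
            ∀ j, g (P r q) (P r q i j).1 ≠ (P r q i j).2).card : ℝ) ≤ ν * m) ∧
          ∀ r : Fin k, ∀ q < m * k,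
            (hammingDist (g (P r q)) (g (P r (q + 1))) : ℝ) ≤ η * n).card : ℝ)) := by
  set p : ℝ := (1 / 2 : ℝ) ^ k with hp
  have hp0 : 0 < p := by positivity
  rcases eq_or_lt_of_le hν0 with hν | hν
  · -- `ν = 0`: tilt `t = 1/2`, rate `α p / 4`
    subst hν
    refine concl_false_of_eta_nonpos_tilt hk hα hη le_rfl (t := 2⁻¹) (c := α * p / 8)
      (by norm_num) (by norm_num) (by positivity) ?_
    rw [zero_mul, sub_zero]
    nlinarith
  · -- `0 < ν < p`: tilt `t = ν / p ∈ (0, 1)`, rate `α (p - ν - ν log (p/ν)) / 2`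
    have ht0 : 0 < ν / p := div_pos hν hp0
    have ht1 : ν / p < 1 := (div_lt_one hp0).2 hνp
    have hinv : (ν / p)⁻¹ = p / ν := by rw [inv_div]
    have hx1 : 1 < p / ν := (one_lt_div hν).2 hνp
    have hlog : Real.log (p / ν) < p / ν - 1 :=
      Real.log_lt_sub_one_of_pos (by positivity) hx1.ne'
    have hφ : 0 < p * (1 - ν / p) - ν * Real.log (ν / p)⁻¹ := by
      rw [hinv]
      have e1 : p * (1 - ν / p) = p - ν := by field_simp
      have e2 : ν * (p / ν - 1) = p - ν := by field_simp
      have h3 : ν * Real.log (p / ν) < ν * (p / ν - 1) := mul_lt_mul_of_pos_left hlog hν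
      linarith
    refine concl_false_of_eta_nonpos_tilt hk hα hη hν0 ht0 ht1.le
      (c := α * (p * (1 - ν / p) - ν * Real.log (ν / p)⁻¹) / 2) (by positivity) ?_
    have := mul_pos hα hφ
    linarith

end Main

end Summit.PneNP.PneNP.Cruxes.SolvableImpliesStableSection.Negative
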